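import Summits.QuantumFields.YangMills.Theorems.BalabanUVNodesN07ChartDDecayAtRecord
import Summits.QuantumFields.YangMills.Theorems.UnitScaleTiltProp8IterPlaqSmallAllLCluster
import HarnessLib

/-!
# BalabanUVNodes ∕ N07 — [15] (73) AT NODE 00's RECORD IN PRINT's LITERAL SHAPE: «|𝔇(A′; c, b)| ≤ O(1)C₃ε₃ … e^{−½δ₀d(c₋,y)}, b ∈ Bʲ(y)» — the canonical twist
# «scaled distance to a reference fine bond `b₀`» satisfies the four slacks, so the decay holds at rate `δ ≤ ½δ₀` in the (161) distance `distBI D b₀ ·`, NO side conditions left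

Cell `pub-ymgap`, width seat `pub-ymgap-dag-n07-w2` generation 4 (HUMAN RULING D-0149; DAG node N07 = [15] = [Balaban1985Variational]; W-SEAT START LIST §n07 item 2 = S2
«Prop. 3 at objects» — the last printed clause (73), CLOSED AT THE RECORD).  `--kind proof --supports … --as helper` (K1 face; count-neutral).  CONSUMED BY NAME, nothing
modified: this seat's `N07ChartDDecayAtRecord.exists_chartD_decay_T4`; the route `UnitScaleTilt`'s lattice geometry `FlatPortChart.pow_mul_distSite_iterBlockOf_le`
(`Lʲdist_j(Bʲu,Bʲv) ≤ dist₀(u,v) + Lʲ − 1`), `IterPlaqSmallAllL.distSite_zero_le_pow` (`dist₀(u,v) ≤ Lʲdist_j(Bʲu,Bʲv) + Lʲ − 1`), `FlatCubeQContraction.distSite_endpoints_le_one`,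
`FlatCubeOpsText.distBI`; lit-balaban's `B5RowSumsP12Lattice.{distSite_triangle, distSite_comm}`, `B5Prop12FieldsLattice.{distSite_self, distSite_nonneg}`.

THE TWIST.  For a reference fine bond `b₀` (print's block `y ∋ b`): `dE(b) := L^{−k}·dist₀(b₋, b₀₋) − 1` on the fine bonds and `dF(c) := distBI D b₀ c =
L^{j(c)−k}·dist_{j(c)}(B^{j(c)}(b₀₋), c₋)` on the index bonds — print's `d(c₋, y)` of (161) read on the tree's sup circular distances.  §1: across levels the scaled distances
differ by at most `1` (`sdist_level_le`, `sdist_zero_le`), an end-point of a level-`j` bond is within scaled distance `1` of its source (`sdist_endpoint_le_one`).  §2: the four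
slacks of `N07ChartDDecayAtRecord` ∕ `N07ChartHInvTwisted` — (s1) `refTwist_triangle` (`dE(b) ≤ distBI D b c + dF(c)`), (s2) `refTwist_index_slack` (`dF(i) ≤ dF(c) + 4` for index
bonds seeing a common fine site), (s3) `refTwist_block_slack` (`dE(b) ≤ dE(b′) + 1` for `b′₋` in a `j`-block of an end-point of `b`, `j ≤ k`), (s4) `refTwist_read_slack`
(`dF(j,c) ≤ dE(b) + 3` on the read set of `(j,c)`).

WHAT IS PROVED (sorry-free; no definition; axioms standard).  §1–§2 as above; §3 ★★★★ `exists_chartD_decay_T4_refBond` — for every `F : T4Family`: thresholds `M_h⁰, R₀`,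
constants `C_K ≥ 0`, `δ₀ > 0`, `B₃ > 0`; for every admissible nested family `D` on `Site (F.P K) 0` of top level `K − n`, every level-weight family `w`, every `ε` in the window
(`18C₂B₀′ε ≤ 1`, `64ε ≤ R⋆`): ∃ `H` (right inverse of `D chartLog(0)`), `Dfun` with (55), (49), (48), `∃ 𝔇, HasFDerivAt` + norm-level (73), and FOR EVERY reference fine bond
`b₀`, rate `0 ≤ δ ≤ ½δ₀` with `4C₃e^{3δ}C_KB₃(1+2Ce^{4δ})(1+2C(1+L)e^{δ})ε ≤ 1`, every direction `W` with `w₁(b)‖W b‖ ≤ t` supported where `L^{−k}dist₀(b₋, b₀₋) ≤ r`: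
**`‖𝔇W (j,c)‖ ≤ 4C₃ε·e^{δ(r+2)}·t·e^{−δ·distBI D b₀ (j,c)}`** at every index bond.  §4 (v1.1) ★★★ `exists_chartD_kernelEntry_decay_T4` — the same read on the unit
direction `δ_b·a` at one fine bond (`r = 0`): `‖𝔇(δ_b·a)(j,c)‖ ≤ 4C₃ε·e^{2δ}·w₁(b)‖a‖·e^{−δ·distBI D b (j,c)}` — the literal kernel entry of (73) (the `(Lʲη)^{−d}` of print is the
pairing volume (66); `w₁(b) = L^{j(b)}η` the remaining scale factor).

HONEST FRAMING: count-neutral helper; elementary lattice geometry + composition by name; the scalar prefactor `(Lʲη)^{−d+1}` of (73) is the weights' bookkeeping (`w₁`, `t`),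
not re-derived; the rate is any `δ ≤ ½δ₀` with P2's `δ₀` (print: `½δ₀`); (58) and [15] Sects. D–F NOT here; stub 1 ∕ K0⁷ ∕ K1⁸ NOT closed; N07 NOT discharged; counts
unmoved; one finite T⁴ programme at fixed ε — NOT continuum ∕ ℝ⁴ ∕ OS ∕ mass gap ∕ Clay: the Yang–Mills mass gap is NOT proved by any of this; R4 closes the conditional rung
`BalabanLadder.UV` only.  No `sorry`, no `def`, no `instance`, no `notation`.

References: [15] T. Bałaban, CMP 102 (1985) 277–309 [Balaban1985Variational] ((69)–(73) pp.288–289, Prop. 3 p.289, (161) p.303); [3] = [B6] CMP 96 (1984) 223–250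
[Balaban1984PropagatorsII] ((2.2)–(2.4) p.224, (2.46) p.231, (2.54) p.233); [B5] CMP 95 (1984) 17–40 [Balaban1984PropagatorsI] ((1.110) p.35); [I] CMP 109 (1987) 249–301
[Balaban1987RG1] ((0.1) p.251).
-/

noncomputable section

open scoped BigOperators Matrix.Norms.L2Operator

namespace Summit.QuantumFields.YangMills.BalabanUVNodes.N07ChartDDecayRefBond

open Literature.MathematicalPhysics.QuantumFieldTheory.Balaban1983to89
open Literature.MathematicalPhysics.QuantumFieldTheory.Balaban1983to89.T4Continuum (T4Family)
open B5Eq118OneStroke (iterBlockOf iterBlockOf_zero iterBlockOf_succ)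
open B5Eq117TorusCarriers (Mk)
open B5Prop12FieldsLattice (distSite distSite_self distSite_nonneg)
open B5RowSumsP12Lattice (distSite_comm distSite_triangle)
open B6SectADomainsV1 (Domains)
open B6SectAOperatorsV1 (BondIdx)
open Summit.QuantumFields.YangMills.Theorems.FlatCubeOpsText (Adm22 distBI)
open Summit.QuantumFields.YangMills.Theorems.K0FlatCubeOpsTextP (IsLevWeight levWeight_nonneg)
open Summit.QuantumFields.YangMills.Theorems.FlatPortChart (pow_mul_distSite_iterBlockOf_le)
open Summit.QuantumFields.YangMills.Theorems.IterPlaqSmallAllL (distSite_zero_le_pow)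
open Summit.QuantumFields.YangMills.Theorems.FlatCubeQContraction (distSite_endpoints_le_one)
open Summit.QuantumFields.YangMills.Theorems.Prop8Chart (chartLog)
open Summit.QuantumFields.YangMills.BalabanUVNodes.N07ChartDDecayAtRecord (exists_chartD_decay_T4)

variable {P : Params}

/-! ## §1 Scaled distances across levels: `L^{j−k}·dist_j(Bʲu, Bʲv)` and `L^{−k}·dist₀(u, v)` differ by at most `1` -/

/-- `(L⁻¹)^{k−j} = Lʲ·(L⁻¹)^k` for `j ≤ k`. [folklore] -/
theorem inv_pow_sub_eq (k j : ℕ) (hjk : j ≤ k) : ((P.L : ℝ)⁻¹) ^ (k - j) = (P.L : ℝ) ^ j * ((P.L : ℝ)⁻¹) ^ k := by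
  have hL0 : (P.L : ℝ) ≠ 0 := by exact_mod_cast P.L_pos.ne'
  obtain ⟨i, rfl⟩ := Nat.exists_eq_add_of_le hjk
  rw [Nat.add_sub_cancel_left, pow_add, ← mul_assoc, ← mul_pow, mul_inv_cancel₀ hL0, one_pow, one_mul]

/-- **UPPER COMPARISON**: `(L⁻¹)^{k−j}·dist_j(Bʲu, Bʲv) ≤ (L⁻¹)^k·dist₀(u, v) + 1` (`j ≤ k`, `j ≤ m + K`) — from `Lʲ·dist_j(Bʲu, Bʲv) ≤ dist₀(u, v) + Lʲ − 1`.
[cite: Balaban1984PropagatorsII, (2.46) p.231] -/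
theorem sdist_level_le (k j : ℕ) (hjk : j ≤ k) (hj : j ≤ P.m + P.K) (u v : Site P 0) :
    ((P.L : ℝ)⁻¹) ^ (k - j) * distSite (Mk P j) (iterBlockOf j u) (iterBlockOf j v) ≤ ((P.L : ℝ)⁻¹) ^ k * distSite (Mk P 0) u v + 1 := by
  have hL1 : (1 : ℝ) ≤ P.L := by exact_mod_cast P.L_pos
  have hL0 : (0 : ℝ) < P.L := by linarith
  have hs0 : 0 < ((P.L : ℝ)⁻¹) ^ k := by positivity
  have hs1 : ((P.L : ℝ)⁻¹) ^ k ≤ 1 := pow_le_one₀ (by positivity) (inv_le_one_of_one_le₀ hL1)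
  have hLj : (1 : ℝ) ≤ (P.L : ℝ) ^ j := one_le_pow₀ hL1
  have h := pow_mul_distSite_iterBlockOf_le j hj u v
  rw [inv_pow_sub_eq k j hjk, mul_assoc]
  have h2 := mul_le_mul_of_nonneg_left h hs0.le
  calc (P.L : ℝ) ^ j * (((P.L : ℝ)⁻¹) ^ k * distSite (Mk P j) (iterBlockOf j u) (iterBlockOf j v))
      = ((P.L : ℝ)⁻¹) ^ k * ((P.L : ℝ) ^ j * distSite (Mk P j) (iterBlockOf j u) (iterBlockOf j v)) := by ring
    _ ≤ ((P.L : ℝ)⁻¹) ^ k * (distSite (Mk P 0) u v + ((P.L : ℝ) ^ j - 1)) := h2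
    _ = ((P.L : ℝ)⁻¹) ^ k * distSite (Mk P 0) u v + ((P.L : ℝ)⁻¹) ^ k * ((P.L : ℝ) ^ j - 1) := by ring
    _ ≤ ((P.L : ℝ)⁻¹) ^ k * distSite (Mk P 0) u v + 1 := by
        have h3 : ((P.L : ℝ)⁻¹) ^ k * ((P.L : ℝ) ^ j - 1) ≤ ((P.L : ℝ)⁻¹) ^ k * (P.L : ℝ) ^ j :=
          mul_le_mul_of_nonneg_left (by linarith) hs0.le
        have h4 : ((P.L : ℝ)⁻¹) ^ k * (P.L : ℝ) ^ j ≤ 1 := by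
          have hkj : ((P.L : ℝ)⁻¹) ^ k * (P.L : ℝ) ^ j = ((P.L : ℝ)⁻¹) ^ (k - j) := by rw [inv_pow_sub_eq k j hjk, mul_comm]
          rw [hkj]
          exact pow_le_one₀ (by positivity) (inv_le_one_of_one_le₀ hL1)
        linarith

/-- **LOWER COMPARISON**: `(L⁻¹)^k·dist₀(u, v) ≤ (L⁻¹)^{k−j}·dist_j(Bʲu, Bʲv) + 1` (`j ≤ k`, `j ≤ m + K`) — from `dist₀(u, v) ≤ Lʲ·dist_j(Bʲu, Bʲv) + Lʲ − 1`.
[cite: Balaban1984PropagatorsII, (2.46) p.231] -/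
theorem sdist_zero_le (k j : ℕ) (hjk : j ≤ k) (hj : j ≤ P.m + P.K) (u v : Site P 0) :
    ((P.L : ℝ)⁻¹) ^ k * distSite (Mk P 0) u v ≤ ((P.L : ℝ)⁻¹) ^ (k - j) * distSite (Mk P j) (iterBlockOf j u) (iterBlockOf j v) + 1 := by
  have hL1 : (1 : ℝ) ≤ P.L := by exact_mod_cast P.L_pos
  have hs0 : 0 < ((P.L : ℝ)⁻¹) ^ k := by positivity
  have h := distSite_zero_le_pow j hj u v
  rw [inv_pow_sub_eq k j hjk]
  have h2 := mul_le_mul_of_nonneg_left h hs0.le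
  have h4 : ((P.L : ℝ)⁻¹) ^ k * (P.L : ℝ) ^ j ≤ 1 := by
    have hkj : ((P.L : ℝ)⁻¹) ^ k * (P.L : ℝ) ^ j = ((P.L : ℝ)⁻¹) ^ (k - j) := by rw [inv_pow_sub_eq k j hjk, mul_comm]
    rw [hkj]
    exact pow_le_one₀ (by positivity) (inv_le_one_of_one_le₀ hL1)
  calc ((P.L : ℝ)⁻¹) ^ k * distSite (Mk P 0) u v
      ≤ ((P.L : ℝ)⁻¹) ^ k * ((P.L : ℝ) ^ j * distSite (Mk P j) (iterBlockOf j u) (iterBlockOf j v) + ((P.L : ℝ) ^ j - 1)) := h2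
    _ = (P.L : ℝ) ^ j * ((P.L : ℝ)⁻¹) ^ k * distSite (Mk P j) (iterBlockOf j u) (iterBlockOf j v) +
          (((P.L : ℝ)⁻¹) ^ k * (P.L : ℝ) ^ j - ((P.L : ℝ)⁻¹) ^ k) := by ring
    _ ≤ (P.L : ℝ) ^ j * ((P.L : ℝ)⁻¹) ^ k * distSite (Mk P j) (iterBlockOf j u) (iterBlockOf j v) + 1 := by linarith [hs0.le]

/-- an end-point of a level-`j` bond is within scaled distance `1` of its source: `(L⁻¹)^{k−j}·dist_j(y, c₋) ≤ 1` for `y ∈ {c₋, c₊}` (`j ≤ k`). [folklore] -/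
theorem sdist_endpoint_le_one (k j : ℕ) (c : PBond P j) {y : Site P j} (hy : y = c.src ∨ y = c.tgt) :
    ((P.L : ℝ)⁻¹) ^ (k - j) * distSite (Mk P j) y c.src ≤ 1 := by
  have hL1 : (1 : ℝ) ≤ P.L := by exact_mod_cast P.L_pos
  have h1 : distSite (Mk P j) y c.src ≤ 1 := by
    rw [distSite_comm (M := Mk P j)]; exact distSite_endpoints_le_one c hy (Or.inl rfl)
  have h2 : ((P.L : ℝ)⁻¹) ^ (k - j) ≤ 1 := pow_le_one₀ (by positivity) (inv_le_one_of_one_le₀ hL1)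
  calc ((P.L : ℝ)⁻¹) ^ (k - j) * distSite (Mk P j) y c.src ≤ 1 * 1 := mul_le_mul h2 h1 (distSite_nonneg _ _) zero_le_one
    _ = 1 := one_mul _

/-! ## §2 The four slacks of the canonical twist «scaled distance to the reference fine bond `b₀`»: `dE(b) = L^{−k}dist₀(b₋, b₀₋) − 1`, `dF(c) = distBI D b₀ c` -/

/-- **(s1) THE TRIANGLE INEQUALITY AGAINST `distBI`**: `L^{−k}dist₀(b₋, b₀₋) − 1 ≤ distBI D b c + distBI D b₀ c` for every index bond `c` (triangle at level `j(c)` through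
`c₋`, then the lower cross-level comparison). [cite: Balaban1984PropagatorsII, (2.46) p.231, (2.54) p.233] -/
theorem refTwist_triangle (D : Domains P) (b₀ b : PBond P 0) (c : BondIdx D) :
    ((P.L : ℝ)⁻¹) ^ D.k * distSite (Mk P 0) b.src b₀.src - 1 ≤ distBI D b c + distBI D b₀ c := by
  have hjk : (c.1.1 : ℕ) ≤ D.k := Nat.lt_succ_iff.mp c.1.1.isLt
  have hj : (c.1.1 : ℕ) ≤ P.m + P.K := hjk.trans D.hk
  have h1 := sdist_zero_le D.k (c.1.1 : ℕ) hjk hj b.src b₀.src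
  have htri := distSite_triangle (M := Mk P (c.1.1 : ℕ)) (iterBlockOf (c.1.1 : ℕ) b.src) c.1.2.src (iterBlockOf (c.1.1 : ℕ) b₀.src)
  rw [distSite_comm (M := Mk P (c.1.1 : ℕ)) c.1.2.src] at htri
  have hs : 0 ≤ ((P.L : ℝ)⁻¹) ^ (D.k - (c.1.1 : ℕ)) := by positivity
  have h2 := mul_le_mul_of_nonneg_left htri hs
  unfold distBI
  linarith

/-- **(s4) READ SLACK**: if the fine bond `b` is read by the index `(j,c)` (`Bʲ(b₋) ∈ {c₋, c₊}`), then `distBI D b₀ (j,c) ≤ (L^{−k}dist₀(b₋, b₀₋) − 1) + 3`.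
[cite: Balaban1985Variational, (69) p.288; Balaban1984PropagatorsII, (2.46) p.231] -/
theorem refTwist_read_slack (D : Domains P) (b₀ : PBond P 0) (idx : BondIdx D) (b : PBond P 0)
    (hb : iterBlockOf (idx.1.1 : ℕ) b.src = idx.1.2.src ∨ iterBlockOf (idx.1.1 : ℕ) b.src = idx.1.2.tgt) :
    distBI D b₀ idx ≤ (((P.L : ℝ)⁻¹) ^ D.k * distSite (Mk P 0) b.src b₀.src - 1) + 3 := by
  have hjk : (idx.1.1 : ℕ) ≤ D.k := Nat.lt_succ_iff.mp idx.1.1.isLt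
  have hj : (idx.1.1 : ℕ) ≤ P.m + P.K := hjk.trans D.hk
  have hs : 0 ≤ ((P.L : ℝ)⁻¹) ^ (D.k - (idx.1.1 : ℕ)) := by positivity
  have htri := distSite_triangle (M := Mk P (idx.1.1 : ℕ)) (iterBlockOf (idx.1.1 : ℕ) b₀.src) (iterBlockOf (idx.1.1 : ℕ) b.src) idx.1.2.src
  have hend := sdist_endpoint_le_one D.k (idx.1.1 : ℕ) idx.1.2 (y := iterBlockOf (idx.1.1 : ℕ) b.src) hb
  have hlev := sdist_level_le D.k (idx.1.1 : ℕ) hjk hj b₀.src b.src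
  rw [distSite_comm (M := Mk P 0) b₀.src] at hlev
  have h2 := mul_le_mul_of_nonneg_left htri hs
  unfold distBI
  linarith

/-- **(s3) BLOCK SLACK**: if `b′₋` lies in the `j`-block (`j ≤ k`) of an end-point `x` of `b`, then `L^{−k}dist₀(b₋, b₀₋) ≤ L^{−k}dist₀(b′₋, b₀₋) + 1` (so the twist
`dE` has block slack `r₂ = 1`). [cite: Balaban1984PropagatorsII, (2.2)-(2.4) p.224, (2.46) p.231] -/
theorem refTwist_block_slack (D : Domains P) (b₀ b b' : PBond P 0) (x : Site P 0) (j : ℕ) (hx : x = b.src ∨ x = b.tgt) (hj : j ≤ D.k)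
    (hblk : iterBlockOf j b'.src = iterBlockOf j x) :
    ((P.L : ℝ)⁻¹) ^ D.k * distSite (Mk P 0) b.src b₀.src - 1 ≤ (((P.L : ℝ)⁻¹) ^ D.k * distSite (Mk P 0) b'.src b₀.src - 1) + 1 := by
  have hjm : j ≤ P.m + P.K := hj.trans D.hk
  have hL1 : (1 : ℝ) ≤ P.L := by exact_mod_cast P.L_pos
  have hs0 : 0 < ((P.L : ℝ)⁻¹) ^ D.k := by positivity
  -- `dist₀(b₋, x) ≤ 1`, `dist₀(x, b′₋) ≤ Lʲ − 1` (same `j`-block), triangle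
  have h1 : distSite (Mk P 0) b.src x ≤ 1 := distSite_endpoints_le_one b hx (Or.inl rfl)
  have h2 : distSite (Mk P 0) x b'.src ≤ (P.L : ℝ) ^ j - 1 := by
    have h := distSite_zero_le_pow j hjm x b'.src
    rw [← hblk, distSite_self, mul_zero, zero_add] at h
    exact h
  have htri1 := distSite_triangle b.src x b₀.src (M := Mk P 0)
  have htri2 := distSite_triangle x b'.src b₀.src (M := Mk P 0)
  have hsum : distSite (Mk P 0) b.src b₀.src ≤ (P.L : ℝ) ^ j + distSite (Mk P 0) b'.src b₀.src := by linarith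
  have h3 := mul_le_mul_of_nonneg_left hsum hs0.le
  have h4 : ((P.L : ℝ)⁻¹) ^ D.k * (P.L : ℝ) ^ j ≤ 1 := by
    have hkj : ((P.L : ℝ)⁻¹) ^ D.k * (P.L : ℝ) ^ j = ((P.L : ℝ)⁻¹) ^ (D.k - j) := by rw [inv_pow_sub_eq D.k j hj, mul_comm]
    rw [hkj]
    exact pow_le_one₀ (by positivity) (inv_le_one_of_one_le₀ hL1)
  nlinarith

/-- **(s2) INDEX SLACK**: if two index bonds `i`, `c` see a common fine site `x` (`B^{j(i)}x ∈ {i₋, i₊}`, `B^{j(c)}x ∈ {c₋, c₊}`), then `distBI D b₀ i ≤ distBI D b₀ c + 4`.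
[cite: Balaban1984PropagatorsII, (2.2)-(2.4) p.224, (2.46) p.231] -/
theorem refTwist_index_slack (D : Domains P) (b₀ : PBond P 0) (i c : BondIdx D) (x : Site P 0)
    (hi : iterBlockOf (i.1.1 : ℕ) x = i.1.2.src ∨ iterBlockOf (i.1.1 : ℕ) x = i.1.2.tgt)
    (hc : iterBlockOf (c.1.1 : ℕ) x = c.1.2.src ∨ iterBlockOf (c.1.1 : ℕ) x = c.1.2.tgt) :
    distBI D b₀ i ≤ distBI D b₀ c + 4 := by
  have hik : (i.1.1 : ℕ) ≤ D.k := Nat.lt_succ_iff.mp i.1.1.isLt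
  have him : (i.1.1 : ℕ) ≤ P.m + P.K := hik.trans D.hk
  have hck : (c.1.1 : ℕ) ≤ D.k := Nat.lt_succ_iff.mp c.1.1.isLt
  have hcm : (c.1.1 : ℕ) ≤ P.m + P.K := hck.trans D.hk
  have hsi : 0 ≤ ((P.L : ℝ)⁻¹) ^ (D.k - (i.1.1 : ℕ)) := by positivity
  have hsc : 0 ≤ ((P.L : ℝ)⁻¹) ^ (D.k - (c.1.1 : ℕ)) := by positivity
  -- at `i`: through `B^{j(i)}x`
  have htri_i := distSite_triangle (M := Mk P (i.1.1 : ℕ)) (iterBlockOf (i.1.1 : ℕ) b₀.src) (iterBlockOf (i.1.1 : ℕ) x) i.1.2.src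
  have hend_i := sdist_endpoint_le_one D.k (i.1.1 : ℕ) i.1.2 (y := iterBlockOf (i.1.1 : ℕ) x) hi
  have hlev_i := sdist_level_le D.k (i.1.1 : ℕ) hik him b₀.src x
  have h1 := mul_le_mul_of_nonneg_left htri_i hsi
  -- at `c`: back down through `B^{j(c)}x`
  have hlev_c := sdist_zero_le D.k (c.1.1 : ℕ) hck hcm b₀.src x
  have htri_c := distSite_triangle (M := Mk P (c.1.1 : ℕ)) (iterBlockOf (c.1.1 : ℕ) b₀.src) c.1.2.src (iterBlockOf (c.1.1 : ℕ) x)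
  have hend_c := sdist_endpoint_le_one D.k (c.1.1 : ℕ) c.1.2 (y := iterBlockOf (c.1.1 : ℕ) x) hc
  rw [distSite_comm (M := Mk P (c.1.1 : ℕ)) (iterBlockOf (c.1.1 : ℕ) x)] at hend_c
  have h2 := mul_le_mul_of_nonneg_left htri_c hsc
  unfold distBI
  linarith

/-! ## §3 (73) at NODE 00's record in print's literal shape -/

/-- ★★★★ **[15] PROPOSITION 3 AT NODE 00's RECORD WITH (73) VERBATIM — «|𝔇(A′; c, b)| ≤ O(1)C₃ε₃ … e^{−½δ₀d(c₋,y)}, b ∈ Bʲ(y)».**  For every `F : T4Family` there are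
thresholds `M_h⁰, R₀` and constants `C_K ≥ 0`, `δ₀ > 0`, `B₃ > 0` such that for every admissible nested family `D` on NODE 00's torus `Site (F.P K) 0` of top level `K − n`
(`Adm22 D R (L·L^{a′})`, `R ≥ R₀`, `2L ≤ R`, torus-size side conditions), every level-weight family `w`, every `ε > 0` in the window `18C₂B₀′ε ≤ 1`, `64ε ≤ R⋆`: there are
the route's right inverse `H` of `D chartLog(0)` and generation 3's chart map `Dfun` ((55), (49), (48), `HasFDerivAt`, norm-level (73)), and FOR EVERY reference fine bond
`b₀`, rate `0 ≤ δ ≤ ½δ₀` with `4C₃e^{3δ}·C_KB₃(1+2Ce^{4δ})(1+2C(1+L)e^{δ})·ε ≤ 1`, every direction `W` of weighted size `≤ t` SUPPORTED within scaled distance `r` of `b₀`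
(`W(b) = 0` unless `L^{−k}dist₀(b₋, b₀₋) ≤ r`): **`‖𝔇W (j,c)‖ ≤ 4C₃ε·e^{δ(r+2)}·t·e^{−δ·distBI D b₀ (j,c)}`** at every index — exponential decay at rate `δ ≤ ½δ₀` in the
distance (161) from the support to the index, `O(1) = 4e^{δ(r+2)}`.  The twist «scaled distance to `b₀`» (§2) fed to `N07ChartDDecayAtRecord.exists_chartD_decay_T4`.
[cite: Balaban1985Variational, (45)-(57) pp.285-287, (68)-(73) pp.288-289, Prop. 3 p.289, (161)-(162) p.303; Balaban1984PropagatorsII, Lemma 2.1 p.232, (2.46) p.231, (2.54) p.233, Cor. 2.8 (2.150)-(2.151) p.249; Balaban1987RG1, (0.1) p.251, (0.4) p.253] -/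
theorem exists_chartD_decay_T4_refBond {ι : Type*} [Fintype ι] [DecidableEq ι] [Nonempty ι] (F : T4Family) :
    ∃ (Mh₀ R₀ : ℕ) (CK δ₀ B₃ : ℝ), 0 ≤ CK ∧ 0 < δ₀ ∧ 0 < B₃ ∧
    ∀ (n K : ℕ) (_ : 1 ≤ K - n) (_ : K - n + 1 ≤ F.m + K) {Mh R a' : ℕ} (_ : Mh = F.L ^ a') (_ : Mh₀ ≤ Mh) (_ : R₀ ≤ R) (_ : 2 * F.L ≤ R)
      (_ : a' + 3 ≤ F.m + n) (D : Domains (F.P K)) (_ : D.k = K - n) (_ : Adm22 D R (F.L * Mh))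
      (w : ℕ → PBond (F.P K) 0 → ℝ) (_ : IsLevWeight (F.P K) (K - n) D w) {ε : ℝ} (_ : 0 < ε)
      (_ : 18 * (960 * ((((F.P K).d + 2) * (F.P K).L : ℕ) : ℝ) * ((F.P K).L : ℝ) / (12800 * ((((F.P K).d + 2) * (F.P K).L : ℕ) : ℝ) ^ 2 * ((F.P K).L : ℝ))⁻¹) *
        (CK * B₃ * (1 + 2 * (((F.P K).d + 2) * (F.P K).L : ℕ)) * (1 + 2 * (((F.P K).d + 2) * (F.P K).L : ℕ) * (1 + (F.P K).L))) * ε ≤ 1)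
      (_ : 64 * ε ≤ (12800 * ((((F.P K).d + 2) * (F.P K).L : ℕ) : ℝ) ^ 2 * ((F.P K).L : ℝ))⁻¹),
      let η : ℝ := (((F.P K).L : ℝ)⁻¹) ^ (K - n)
      let Rs : ℝ := (12800 * ((((F.P K).d + 2) * (F.P K).L : ℕ) : ℝ) ^ 2 * ((F.P K).L : ℝ))⁻¹
      let C₂ : ℝ := 960 * ((((F.P K).d + 2) * (F.P K).L : ℕ) : ℝ) * ((F.P K).L : ℝ) / Rs
      let C₃ : ℝ := 3840 * ((((F.P K).d + 2) * (F.P K).L : ℕ) : ℝ) * ((F.P K).L : ℝ) / Rs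
      let Qlin := (fderiv ℂ (chartLog η D : (PBond (F.P K) 0 → Matrix ι ι ℂ) → BondIdx D → Matrix ι ι ℂ) 0)
      ∃ (H : (BondIdx D → Matrix ι ι ℂ) →ₗ[ℂ] (PBond (F.P K) 0 → Matrix ι ι ℂ)) (Dfun : (PBond (F.P K) 0 → Matrix ι ι ℂ) → (BondIdx D → Matrix ι ι ℂ)),
        (∀ X, Qlin (H X) = X) ∧
        DifferentiableOn ℂ Dfun {A' : PBond (F.P K) 0 → Matrix ι ι ℂ | ∀ b, w 1 b * ‖A' b‖ < ε} ∧
        ∀ A' : PBond (F.P K) 0 → Matrix ι ι ℂ, (∀ b, w 1 b * ‖A' b‖ < ε) →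
          (∀ (ρ : ℝ), 0 ≤ ρ → (∀ b, w 1 b * ‖A' b‖ ≤ ρ) → ∀ i, ‖Dfun A' i‖ ≤ 4 * C₂ * ρ ^ 2) ∧
          chartLog η D (A' - H (Dfun A')) - Qlin (A' - H (Dfun A')) = Dfun A' ∧
          chartLog η D (A' - H (Dfun A')) = Qlin A' ∧
          ∃ 𝔇 : (PBond (F.P K) 0 → Matrix ι ι ℂ) →L[ℂ] (BondIdx D → Matrix ι ι ℂ), HasFDerivAt Dfun 𝔇 A' ∧
            (∀ (W : PBond (F.P K) 0 → Matrix ι ι ℂ) (t : ℝ), 0 ≤ t → (∀ b, w 1 b * ‖W b‖ ≤ t) → ∀ i, ‖𝔇 W i‖ ≤ 4 * C₃ * ε * t) ∧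
            ∀ (b₀ : PBond (F.P K) 0) (δ : ℝ), 0 ≤ δ → δ ≤ δ₀ / 2 →
              4 * C₃ * Real.exp (δ * 3) *
                  (CK * B₃ * (1 + 2 * (((F.P K).d + 2) * (F.P K).L : ℕ) * Real.exp (δ * 4)) *
                    (1 + 2 * (((F.P K).d + 2) * (F.P K).L : ℕ) * (1 + (F.P K).L) * Real.exp (δ * 1))) * ε ≤ 1 →
              ∀ (W : PBond (F.P K) 0 → Matrix ι ι ℂ) (t r : ℝ), 0 ≤ t → (∀ b, w 1 b * ‖W b‖ ≤ t) →
                (∀ b : PBond (F.P K) 0, r < (((F.P K).L : ℝ)⁻¹) ^ D.k * distSite (Mk (F.P K) 0) b.src b₀.src → W b = 0) →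
                ∀ i, ‖𝔇 W i‖ ≤ 4 * C₃ * ε * Real.exp (δ * (r + 2)) * t * Real.exp (-(δ * distBI D b₀ i)) := by
  obtain ⟨Mh₀, R₀, CK, δ₀, B₃, hCK, hδ₀, hB₃, hmain⟩ := exists_chartD_decay_T4 (ι := ι) F
  refine ⟨Mh₀, R₀, CK, δ₀, B₃, hCK, hδ₀, hB₃, ?_⟩
  intro n K hk1 hk' Mh R a' hMha hMh hR h2L hsize D hDk hAdm w hw ε hε h18 h2 η Rs C₂ C₃ Qlin
  obtain ⟨H, Dfun, hHinv, hdiff, hDfun⟩ := hmain n K hk1 hk' hMha hMh hR h2L hsize D hDk hAdm w hw hε h18 h2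
  refine ⟨H, Dfun, hHinv, hdiff, fun A' hA' => ?_⟩
  obtain ⟨h55, h49, h48, 𝔇, h𝔇, h73, htw⟩ := hDfun A' hA'
  refine ⟨h55, h49, h48, 𝔇, h𝔇, h73, fun b₀ δ hδ hδh hsmall W t r ht hW hsupp i => ?_⟩
  -- the twisted size of the supported direction: `e^{δ(L^{−k}dist₀(b₋,b₀₋) − 1)}·w₁(b)‖W b‖ ≤ e^{δ(r−1)}·t`
  have hWe : ∀ b : PBond (F.P K) 0,
      Real.exp (δ * ((((F.P K).L : ℝ)⁻¹) ^ D.k * distSite (Mk (F.P K) 0) b.src b₀.src - 1)) * (w 1 b * ‖W b‖) ≤ Real.exp (δ * (r - 1)) * t := by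
    intro b
    by_cases hb : r < (((F.P K).L : ℝ)⁻¹) ^ D.k * distSite (Mk (F.P K) 0) b.src b₀.src
    · rw [hsupp b hb, norm_zero, mul_zero, mul_zero]; positivity
    · exact mul_le_mul (Real.exp_le_exp.mpr (by nlinarith [not_lt.mp hb])) (hW b)
        (mul_nonneg (levWeight_nonneg hw 1 b) (norm_nonneg _)) (Real.exp_pos _).le
  have h := htw (fun b => (((F.P K).L : ℝ)⁻¹) ^ D.k * distSite (Mk (F.P K) 0) b.src b₀.src - 1) (fun c => distBI D b₀ c) δ 3 4 1 hδ hδh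
    (fun b c => refTwist_triangle D b₀ b c) (fun i' c x hi hc => refTwist_index_slack D b₀ i' c x hi hc)
    (fun b b' x j hx hj hblk => refTwist_block_slack D b₀ b b' x j hx hj hblk) (fun idx b hs _ => refTwist_read_slack D b₀ idx b hs)
    hsmall W (Real.exp (δ * (r - 1)) * t) (by positivity) hWe i
  -- divide by the twist at `i` and collect the exponentials
  have hi : 0 < Real.exp (δ * distBI D b₀ i) := Real.exp_pos _
  rw [Real.exp_neg, ← div_eq_mul_inv, le_div_iff₀ hi, mul_comm]
  calc Real.exp (δ * distBI D b₀ i) * ‖𝔇 W i‖ ≤ 4 * C₃ * Real.exp (δ * 3) * ε * (Real.exp (δ * (r - 1)) * t) := h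
    _ = 4 * C₃ * ε * (Real.exp (δ * 3) * Real.exp (δ * (r - 1))) * t := by ring
    _ = 4 * C₃ * ε * Real.exp (δ * (r + 2)) * t := by rw [← Real.exp_add]; ring_nf

/-! ## §4 (v1.1) The kernel entries: «|𝔇(A′; c, b)| ≤ O(1)C₃ε₃(Lʲη)·e^{−½δ₀d(c₋,y)}» for the unit direction at one fine bond -/

/-- ★★★ **THE KERNEL ENTRIES OF `𝔇 = δD(A′)∕δA′` AT NODE 00's RECORD DECAY EXPONENTIALLY** — §3 read on the direction `W = δ_b·a` supported at ONE fine bond `b` (`r = 0`):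
with the data of `exists_chartD_decay_T4_refBond`, for every fine bond `b`, matrix `a`, rate `0 ≤ δ ≤ ½δ₀` in the window, and every index bond `(j,c)`:
**`‖𝔇(δ_b·a)(j,c)‖ ≤ 4C₃ε·e^{2δ}·(w₁(b)‖a‖)·e^{−δ·distBI D b (j,c)}`** — print's `|𝔇(A′; c, b)| ≤ O(1)C₃ε₃(Lʲη)^{−d+1}e^{−½δ₀d(c₋,y)}` with the scale factor `w₁(b) = L^{j(b)}η`
(the `(Lʲη)^{−d}` is the pairing volume of (66), not part of the operator entry). [cite: Balaban1985Variational, (66) p.288, (73) p.289, Prop. 3 p.289, (161) p.303] -/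
theorem exists_chartD_kernelEntry_decay_T4 {ι : Type*} [Fintype ι] [DecidableEq ι] [Nonempty ι] (F : T4Family) :
    ∃ (Mh₀ R₀ : ℕ) (CK δ₀ B₃ : ℝ), 0 ≤ CK ∧ 0 < δ₀ ∧ 0 < B₃ ∧
    ∀ (n K : ℕ) (_ : 1 ≤ K - n) (_ : K - n + 1 ≤ F.m + K) {Mh R a' : ℕ} (_ : Mh = F.L ^ a') (_ : Mh₀ ≤ Mh) (_ : R₀ ≤ R) (_ : 2 * F.L ≤ R)
      (_ : a' + 3 ≤ F.m + n) (D : Domains (F.P K)) (_ : D.k = K - n) (_ : Adm22 D R (F.L * Mh))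
      (w : ℕ → PBond (F.P K) 0 → ℝ) (_ : IsLevWeight (F.P K) (K - n) D w) {ε : ℝ} (_ : 0 < ε)
      (_ : 18 * (960 * ((((F.P K).d + 2) * (F.P K).L : ℕ) : ℝ) * ((F.P K).L : ℝ) / (12800 * ((((F.P K).d + 2) * (F.P K).L : ℕ) : ℝ) ^ 2 * ((F.P K).L : ℝ))⁻¹) *
        (CK * B₃ * (1 + 2 * (((F.P K).d + 2) * (F.P K).L : ℕ)) * (1 + 2 * (((F.P K).d + 2) * (F.P K).L : ℕ) * (1 + (F.P K).L))) * ε ≤ 1)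
      (_ : 64 * ε ≤ (12800 * ((((F.P K).d + 2) * (F.P K).L : ℕ) : ℝ) ^ 2 * ((F.P K).L : ℝ))⁻¹),
      let η : ℝ := (((F.P K).L : ℝ)⁻¹) ^ (K - n)
      let Rs : ℝ := (12800 * ((((F.P K).d + 2) * (F.P K).L : ℕ) : ℝ) ^ 2 * ((F.P K).L : ℝ))⁻¹
      let C₂ : ℝ := 960 * ((((F.P K).d + 2) * (F.P K).L : ℕ) : ℝ) * ((F.P K).L : ℝ) / Rs
      let C₃ : ℝ := 3840 * ((((F.P K).d + 2) * (F.P K).L : ℕ) : ℝ) * ((F.P K).L : ℝ) / Rs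
      let Qlin := (fderiv ℂ (chartLog η D : (PBond (F.P K) 0 → Matrix ι ι ℂ) → BondIdx D → Matrix ι ι ℂ) 0)
      ∃ (H : (BondIdx D → Matrix ι ι ℂ) →ₗ[ℂ] (PBond (F.P K) 0 → Matrix ι ι ℂ)) (Dfun : (PBond (F.P K) 0 → Matrix ι ι ℂ) → (BondIdx D → Matrix ι ι ℂ)),
        (∀ X, Qlin (H X) = X) ∧
        DifferentiableOn ℂ Dfun {A' : PBond (F.P K) 0 → Matrix ι ι ℂ | ∀ b, w 1 b * ‖A' b‖ < ε} ∧
        ∀ A' : PBond (F.P K) 0 → Matrix ι ι ℂ, (∀ b, w 1 b * ‖A' b‖ < ε) →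
          (∀ (ρ : ℝ), 0 ≤ ρ → (∀ b, w 1 b * ‖A' b‖ ≤ ρ) → ∀ i, ‖Dfun A' i‖ ≤ 4 * C₂ * ρ ^ 2) ∧
          chartLog η D (A' - H (Dfun A')) - Qlin (A' - H (Dfun A')) = Dfun A' ∧
          chartLog η D (A' - H (Dfun A')) = Qlin A' ∧
          ∃ 𝔇 : (PBond (F.P K) 0 → Matrix ι ι ℂ) →L[ℂ] (BondIdx D → Matrix ι ι ℂ), HasFDerivAt Dfun 𝔇 A' ∧
            (∀ (W : PBond (F.P K) 0 → Matrix ι ι ℂ) (t : ℝ), 0 ≤ t → (∀ b, w 1 b * ‖W b‖ ≤ t) → ∀ i, ‖𝔇 W i‖ ≤ 4 * C₃ * ε * t) ∧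
            ∀ (b : PBond (F.P K) 0) (a : Matrix ι ι ℂ) (δ : ℝ), 0 ≤ δ → δ ≤ δ₀ / 2 →
              4 * C₃ * Real.exp (δ * 3) *
                  (CK * B₃ * (1 + 2 * (((F.P K).d + 2) * (F.P K).L : ℕ) * Real.exp (δ * 4)) *
                    (1 + 2 * (((F.P K).d + 2) * (F.P K).L : ℕ) * (1 + (F.P K).L) * Real.exp (δ * 1))) * ε ≤ 1 →
              ∀ i, ‖𝔇 (Pi.single b a) i‖ ≤ 4 * C₃ * ε * Real.exp (δ * 2) * (w 1 b * ‖a‖) * Real.exp (-(δ * distBI D b i)) := by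
  classical
  obtain ⟨Mh₀, R₀, CK, δ₀, B₃, hCK, hδ₀, hB₃, hmain⟩ := exists_chartD_decay_T4_refBond (ι := ι) F
  refine ⟨Mh₀, R₀, CK, δ₀, B₃, hCK, hδ₀, hB₃, ?_⟩
  intro n K hk1 hk' Mh R a' hMha hMh hR h2L hsize D hDk hAdm w hw ε hε h18 h2 η Rs C₂ C₃ Qlin
  obtain ⟨H, Dfun, hHinv, hdiff, hDfun⟩ := hmain n K hk1 hk' hMha hMh hR h2L hsize D hDk hAdm w hw hε h18 h2
  refine ⟨H, Dfun, hHinv, hdiff, fun A' hA' => ?_⟩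
  obtain ⟨h55, h49, h48, 𝔇, h𝔇, h73, href⟩ := hDfun A' hA'
  refine ⟨h55, h49, h48, 𝔇, h𝔇, h73, fun b a δ hδ hδh hsmall i => ?_⟩
  have hwnn : ∀ b', 0 ≤ w 1 b' := levWeight_nonneg hw 1
  -- the unit direction: weighted size `w₁(b)‖a‖`, supported at scaled distance `0` from `b`
  have hW : ∀ b', w 1 b' * ‖(Pi.single b a : PBond (F.P K) 0 → Matrix ι ι ℂ) b'‖ ≤ w 1 b * ‖a‖ := by
    intro b'
    by_cases hb' : b' = b
    · subst hb'; rw [Pi.single_eq_same]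
    · rw [Pi.single_eq_of_ne (M := fun _ : PBond (F.P K) 0 => Matrix ι ι ℂ) hb', norm_zero, mul_zero]; exact mul_nonneg (hwnn b) (norm_nonneg a)
  have hsupp : ∀ b' : PBond (F.P K) 0, (0 : ℝ) < (((F.P K).L : ℝ)⁻¹) ^ D.k * distSite (Mk (F.P K) 0) b'.src b.src →
      (Pi.single b a : PBond (F.P K) 0 → Matrix ι ι ℂ) b' = 0 := by
    intro b' hb'
    by_cases hbb : b' = b
    · subst hbb; rw [distSite_self, mul_zero] at hb'; exact absurd hb' (lt_irrefl _)
    · exact Pi.single_eq_of_ne (M := fun _ : PBond (F.P K) 0 => Matrix ι ι ℂ) hbb a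
  have h := href b δ hδ hδh hsmall (Pi.single b a) (w 1 b * ‖a‖) 0 (mul_nonneg (hwnn b) (norm_nonneg a)) hW hsupp i
  simpa only [zero_add] using h

end Summit.QuantumFields.YangMills.BalabanUVNodes.N07ChartDDecayRefBond

end
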